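import Mathlib
import HarnessLib
import Summits.Langlands.Langlands.Theses.RamifiedCoefficientSeed
import Summits.Langlands.Langlands.Theorems.RamifiedCoefficientSeedExplicitRamifiedFamilyStubNotTwistEquivalent
import Summits.Langlands.Langlands.Theorems.RamifiedCoefficientSeedExplicitRamifiedFamilyStubNotEssSelfDual
import Summits.Langlands.Langlands.Theorems.RamifiedCoefficientSeedExplicitRamifiedFamilyStubResidualDuality

/-!
# Birth skeleton (BC3) for crux stmt-Langlands-16778 — RESHAPE 2 (lead continuation c1, 2026-08-17)
`Summit.Langlands.Langlands.Theses.RamifiedCoefficientSeed.ExplicitRamifiedFamily` — line `birth`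

Route `route-Langlands-RamifiedCoefficientSeed` (rev 3; `closes (h1 : ExplicitRamifiedFamily)
(h2 : AdjointSeedFromDuality) (h3 : AdjointLiftingGL3) (h4 : SectorComplement) : Langlands`; this crux is
`h1`, rank 2, the EXPLICIT-WITNESS / compute seat).  THE CRUX: `∃ p ≥ 11, ∃ f : ℕ → (Γ_ℚ → GL₃(ℚ̄_p))`
pairwise twist-inequivalent, every member (A) NOT essentially self-dual, (B) unramified a.e.,
(C) crystalline with labelled HT weights `{0,1,2}` at `p` FOR THE PINNED Fontaine datum, (D) residually
essentially self-dual (trace form `‖·‖ < 1`), (E) `ρ̄|ℚ(ζ_p)` absolutely irreducible, (F) a complex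
conjugation of trace `±1`.

## History of the line
* Registration (planner-skel, 2026-08-17T04:58Z): 3 stubs — certified family (core) + two one-element
  certificate lemmas for PW / (A).
* Wave 1 (lead c0, 11:36–12:02Z): the two certificate lemmas LANDED (p158189
  `stub_not_twistEquivalent_of_certificate`, p158260 `stub_not_essSelfDual_of_certificate`, both
  `--supports stmt-Langlands-16778`, imported below and used BY NAME in the composition); skeleton
  reshaped to ONE open stub `stub_certifiedSeedFamily` = the crux core with certificates.
* RESHAPE 2 (lead c1, this file).  The single open stub inherited, verbatim, the two standing blocks
  that every seat has recorded (refuter REVIEW §4, rattack VETTING, SKELVET advisory, STRATEGY-CENSUS §0,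
  LEAD-CYCLE1, and — kernel-checked — `Cruxes/ExplicitRamifiedFamily/Disproof.lean` §2–3):
  (I2) the Weil–Deligne half of (C) `IsCrystallineFramed` at the ε-pinned `fontainePstAdicCompletion`
  is constrained by no accepted clause on a ρ ramified at `p` (the adversarial datum `advDatumAt` lies
  in ε's subtype and falsifies the datum-parametrised crux modulo a true labelled-`B_dR` fact), so (C)
  is underivable and irrefutable for every candidate member until `defn-FontainePstWeilDeligneData`
  (iii) (D2: `WD ∘ D_pst`) lands or a comparison clause is added to `IsFontaineDatum`;
  (I1) the tree has no constructor of an irreducible, non-essentially-self-dual rank-3 ρ of `Γ_ℚ` with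
  three distinct weights (no `H²_ét`, no `r_ι(π)`; inductions from cubic fields have parallel weights,
  `Sym²`-twists are essentially self-dual), and on paper an infinite twist-inequivalent supply at one
  `p ≥ 11` has no source in print (open AG search: the two crux-ideate cards).
  This reshape SEPARATES the two blocks into two registered stubs and isolates the route's lever as a
  third, provable one:
  - STUB 1 `stub_ordinaryConjDualCertifiedFamily` — the core, now DATUM-FREE and DECIDABLE: (C) is
    replaced by ORD-GEN(0,1,2) at `v ∣ p` (a `Γ_{ℚ_v}`-stable full flag with inertial diagonal
    `ε⁰, ε⁻¹, ε⁻²` and pairwise distinct unramified parts — the honest local condition on the intended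
    geometric source with good ORDINARY reduction, exactly the core of the strategist's alternative line
    `Lines/ordinary_transfer.lean`), and (D) is replaced by what a conjugation-ramified coefficient prime
    actually delivers, (D′): an EXACT duality `ν(σ) tr ρ(σ⁻¹) = s(tr ρ(σ))` read through a residually
    trivial ring endomorphism `s` of `ℚ̄_p` (the lift into inertia of complex conjugation of `E` along
    `E_λ`, `c(λ) = λ`, `c ≡ id mod λ`; the unitary / Poincaré duality `ρᶜ ≅ ρ^∨ ⊗ ν` on Frobenius traces,
    spread to all σ by Chebotarev).  STATUS: (I1)-blocked in Lean, open on paper; attackable by a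
    disprover (it is decidable) and by a compute/AG seat.
  - STUB 2 `stub_pinnedCrystalline_of_ordinaryGeneric` — the TRANSFER clause "ORD-GEN(0,1,2) ⇒
    pinned-crystalline with labelled weights `{0,1,2}`", VERBATIM the strategist's stub of the same name
    (so one landing serves both lines).  TRUE for Fontaine's datum (Perrin-Riou 1994: ordinary ⇒
    semi-stable; genericity of the unit parts kills `N`; `HT(ε) = −1`).  STATUS: (I2)-blocked — do not
    staff before `defn-FontainePstWeilDeligneData` (iii) or an `IsFontaineDatum` clause (F13) of this shape.
  - STUB 3 `stub_residualDuality_of_conjDuality` — the LEVER at trace level: (D′) ⇒ (D) (integrality of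
    traces + the residual triviality of `s`).  Provable now (S); landed by the lead right after
    registration.
  Composition `ExplicitRamifiedFamily_of : STUB 1 → STUB 2 → crux` is pure logic and uses the three landed
  lemmas (two certificates, the lever) by their tree names.  Sorries: exactly stubs 1–2.

INTERFACE CAVEAT, said openly: nothing in this file makes the crux closable today; the reshape records
in REGISTERED form which named piece of infrastructure blocks which conjunct (stub 2 ↔ D2; stub 1 ↔ the
missing geometric constructor and the open explicit search), lands the one piece of the route's mechanism
that is provable at this level (stub 3), and hands the planner a decidable core.

Shape (for `ledger skeleton check` / `#h21_check_skeleton`): each open stub is `theorem stub_<name> :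
<signature> := by sorry` (closed statements over existing declarations only); `_Goal.stub_<name> : Prop :=
type_of% @stub_<name>` names it; the composition takes `(h₁ : _Goal.…) (h₂ : _Goal.…) (h₃ : _Goal.…)` and
concludes the route decl BY (fully qualified) NAME; the final `example` feeds the stubs to it.
STATE after wave 2 (lead c1): stub 3 landed (p161017); sorries = stubs 1–2.

Disproof used: `Cruxes/ExplicitRamifiedFamily/Disproof.lean` (cdisprove cycle 1, 2026-08-17T12:07Z, rc 0,
0 sorry) — read in full.  Its `_false`-type content is `not_explicitRamifiedFamilyFor_advDatumAt` (the
datum-parametrised crux is false at an admissible adversarial datum, mod `UnramifiedWeightsNe012 pinned`)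
and `pin_load_bearing`; no `-- Targets` theorem kills a stub (stubs 2–3 of wave 1 re-derived TRUE there,
§6).  What this reshape takes from it: (C1) is the load-bearing undetermined conjunct ⇒ isolated as STUB 2
(a universal clause, the form in which a Literature seat can discharge it as (F13) under
`FontaineDatumExists`, or D2 can prove it); its junk-family ledger §4 (crux − (E) true by CFT, crux − (A)
true by `Sym²`) ⇒ (E) and the (A)-certificate stay in the core verbatim; its typing audit §5 ⇒ no change of
conventions (`HT(ε) = {−1}`, weights `{0,1,2}`).  `ledger negatives` / dead lines: none of this shape
(payload `dead_lines = []`).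
-/

set_option linter.dupNamespace false

noncomputable section

namespace Summit.Langlands.Langlands.Cruxes.ExplicitRamifiedFamily.Birth

open Summit.Langlands.Langlands.Theses.RamifiedCoefficientSeed
open Literature.NumberTheory.GaloisRepresentations
open Filter IsDedekindDomain
open scoped NumberField MatrixGroups

/-! ## 1. The open stubs (1–2) and the landed lever (3) -/

/-- **STUB 1 — the ORDINARY-GENERIC, CONJUGATE-DUAL certified family** (open core; explicit algebraic
geometry + arithmetic; DATUM-FREE and decidable; blocked in Lean by the missing `H²_ét` / `r_ι(π)`
constructor, open on paper).  There are a prime `p ≥ 11` and `f : ℕ → (Γ_ℚ → GL₃(ℚ̄_p))` with: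
(pairs) for `m ≠ n` one `σ` with `tr(f m σ)³·det(f n σ) ≠ tr(f n σ)³·det(f m σ)` (twist-inequivalence
certificate); (members) one `σ` with `((tr M)² − tr M²)³ ≠ 8 (tr M)³ det M`, `M = f n σ`
(non-essential-self-duality certificate); unramified a.e.; ORD-GEN(0,1,2) at every `v ∣ p` (a frame
`g` making `ρ|_{Γ_{ℚ_v}}` lower-triangular with inertial diagonal `ε⁰, ε⁻¹, ε⁻²` and pairwise distinct
unramified parts `M_{ii}·εⁱ`); (D′) an EXACT duality `ν(σ)·tr ρ(σ⁻¹) = s(tr ρ(σ))` for a character `ν`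
and a ring endomorphism `s` of `ℚ̄_p` with `‖s x − x‖ < 1` on `‖x‖ ≤ 1` (what the unitary / Poincaré
duality `ρᶜ ≅ ρ^∨ ⊗ ν` of an `E`-rational system gives at a prime `λ` of the CM field `E` with
`c(λ) = λ`, `c ≡ id mod λ`, `s` = a lift of `c|_{E_λ}` into the inertia of `Gal(ℚ̄_p/ℚ_p)`);
`ρ̄|ℚ(ζ_p)` absolutely irreducible; a complex conjugation of trace `±1`.  Intended source: `λ`-adic
(1,1,1)-eigenpieces of `H²` of surfaces over `ℚ` with a `ℚ`-RATIONAL automorphism of order `p^k`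
(`E = ℚ(ζ_{p^k})`, `λ = (1 − ζ)`) and good ORDINARY reduction at `p` — canonical `p_g = 10` surfaces in
`ℙ⁹` with the cyclic shift (card `rational-cyclic-rigidity`) or étale 11-isogeny pull-backs
`S = Y ×_{Alb} J` over `p_g = q = 2` surfaces (card `isogeny-cover-seed`).
Why it might fail: the eigenspace / ℚ-rationality numerology may admit no rank-3 (1,1,1) piece for any
`p^k ≥ 11`; an infinite twist-inequivalent supply at ONE `p` has no source in print.
[cite: VangeemenTop1994, §1] [cite: ItoKoshikawaMieda2018, Prop. 3.7] [cite: Greenberg1991, §2]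
[cite: AshGraysonGreen1984, Table I and p. 434 remark (3)] -/
theorem stub_ordinaryConjDualCertifiedFamily :
    ∃ (p : ℕ) (_ : Fact p.Prime), 11 ≤ p ∧
      ∃ f : ℕ → Literature.NumberTheory.GaloisRepresentations.FramedGaloisRep ℚ (PadicAlgCl p) 3,
        (∀ m n, m ≠ n → ∃ σ : Field.absoluteGaloisGroup ℚ,
            (f m σ).val.trace ^ 3 * (f n σ).val.det ≠ (f n σ).val.trace ^ 3 * (f m σ).val.det) ∧
        ∀ n,
          (∃ σ : Field.absoluteGaloisGroup ℚ,
              ((f n σ).val.trace ^ 2 - ((f n σ).val ^ 2).trace) ^ 3 ≠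
                8 * (f n σ).val.trace ^ 3 * (f n σ).val.det) ∧
          (∀ᶠ v : IsDedekindDomain.HeightOneSpectrum (NumberField.RingOfIntegers ℚ) in Filter.cofinite,
              (f n).IsUnramifiedAt v) ∧
          (∀ (v : IsDedekindDomain.HeightOneSpectrum (NumberField.RingOfIntegers ℚ))
              (_hv : ((p : ℕ) : NumberField.RingOfIntegers ℚ) ∈ v.asIdeal),
              ∃ g : GL (Fin 3) (PadicAlgCl p),
                (∀ (τ : Field.absoluteGaloisGroup (v.adicCompletion ℚ)) (i j : Fin 3), j < i →
                    ((g * (f n).toLocal v τ * g⁻¹ : GL (Fin 3) (PadicAlgCl p)) :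
                      Matrix (Fin 3) (Fin 3) (PadicAlgCl p)) i j = 0) ∧
                (∀ τ ∈ absInertia (v.adicCompletion ℚ), ∀ i : Fin 3,
                    ((g * (f n).toLocal v τ * g⁻¹ : GL (Fin 3) (PadicAlgCl p)) :
                      Matrix (Fin 3) (Fin 3) (PadicAlgCl p)) i i =
                      algebraMap ℚ_[p] (PadicAlgCl p)
                        ((((GaloisRep.cyclotomicCharacter (v.adicCompletion ℚ) p τ)⁻¹ : ℤ_[p]ˣ) :
                          ℤ_[p]) : ℚ_[p]) ^ (i : ℕ)) ∧
                (∀ i j : Fin 3, i ≠ j → ∃ τ : Field.absoluteGaloisGroup (v.adicCompletion ℚ),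
                    ((g * (f n).toLocal v τ * g⁻¹ : GL (Fin 3) (PadicAlgCl p)) :
                      Matrix (Fin 3) (Fin 3) (PadicAlgCl p)) i i *
                        algebraMap ℚ_[p] (PadicAlgCl p)
                          ((((GaloisRep.cyclotomicCharacter (v.adicCompletion ℚ) p τ) : ℤ_[p]ˣ) :
                            ℤ_[p]) : ℚ_[p]) ^ (i : ℕ) ≠
                    ((g * (f n).toLocal v τ * g⁻¹ : GL (Fin 3) (PadicAlgCl p)) :
                      Matrix (Fin 3) (Fin 3) (PadicAlgCl p)) j j *
                        algebraMap ℚ_[p] (PadicAlgCl p)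
                          ((((GaloisRep.cyclotomicCharacter (v.adicCompletion ℚ) p τ) : ℤ_[p]ˣ) :
                            ℤ_[p]) : ℚ_[p]) ^ (j : ℕ))) ∧
          (∃ (ν : Literature.NumberTheory.GaloisRepresentations.FramedGaloisRep ℚ (PadicAlgCl p) 1)
              (s : PadicAlgCl p →+* PadicAlgCl p),
              (∀ x : PadicAlgCl p, ‖x‖ ≤ 1 → ‖s x - x‖ < 1) ∧
              (∀ σ, (ν σ).val 0 0 * (f n σ⁻¹).val.trace = s ((f n σ).val.trace))) ∧
          ((f n).restrictField (CyclotomicField p ℚ)).IsResiduallyAbsIrreducible ∧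
          (∃ (φ : ℚ →+* ℝ) (c : Field.absoluteGaloisGroup ℚ),
              Literature.NumberTheory.GaloisRepresentations.IsComplexConjugation φ c ∧
                (((f n) c).val.trace = 1 ∨ ((f n) c).val.trace = -1)) := by
  sorry

/-- **STUB 2 — TRANSFER: ordinary-generic of shape `(0,1,2)` at `v ∣ p` is pinned-crystalline with
labelled Hodge–Tate weights `{0,1,2}`** (the comparison clause; universal in `ρ`; VERBATIM the stub of
the same name of `Lines/ordinary_transfer.lean`).  True for Fontaine's datum: Greenberg-ordinary ⇒
semi-stable (Perrin-Riou), `N` lowers `φ`-slopes by one and the unit parts of the `φ`-eigenvalues on the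
graded pieces are pairwise distinct by hypothesis, so `N = 0`: crystalline, `WD(D_pst ρ)` unramified;
weights `{0,1,2}` since `HT(ε) = −1`.  UNPROVABLE in the tree before D2 (`defn-FontainePstWeilDeligneData`
(iii)) or a clause of `IsFontaineDatum` of this shape: the conclusion's `IsWeilDeligneOf` half is pinned by
specification only.  Do not staff before then.
[cite: PerrinRiou1994Ordinaires, Exposé IV] [cite: FontaineAsterisque223VIII, §1.3 and §2.3.7]
[cite: Greenberg1991, §2] -/
theorem stub_pinnedCrystalline_of_ordinaryGeneric :
    ∀ (p : ℕ) [Fact p.Prime]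
      (ρ : Literature.NumberTheory.GaloisRepresentations.FramedGaloisRep ℚ (PadicAlgCl p) 3)
      (v : IsDedekindDomain.HeightOneSpectrum (NumberField.RingOfIntegers ℚ))
      (hv : ((p : ℕ) : NumberField.RingOfIntegers ℚ) ∈ v.asIdeal),
      (∃ g : GL (Fin 3) (PadicAlgCl p),
          (∀ (τ : Field.absoluteGaloisGroup (v.adicCompletion ℚ)) (i j : Fin 3), j < i →
              ((g * ρ.toLocal v τ * g⁻¹ : GL (Fin 3) (PadicAlgCl p)) :
                Matrix (Fin 3) (Fin 3) (PadicAlgCl p)) i j = 0) ∧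
          (∀ τ ∈ absInertia (v.adicCompletion ℚ), ∀ i : Fin 3,
              ((g * ρ.toLocal v τ * g⁻¹ : GL (Fin 3) (PadicAlgCl p)) :
                Matrix (Fin 3) (Fin 3) (PadicAlgCl p)) i i =
                algebraMap ℚ_[p] (PadicAlgCl p)
                  ((((GaloisRep.cyclotomicCharacter (v.adicCompletion ℚ) p τ)⁻¹ : ℤ_[p]ˣ) :
                    ℤ_[p]) : ℚ_[p]) ^ (i : ℕ)) ∧
          (∀ i j : Fin 3, i ≠ j → ∃ τ : Field.absoluteGaloisGroup (v.adicCompletion ℚ),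
              ((g * ρ.toLocal v τ * g⁻¹ : GL (Fin 3) (PadicAlgCl p)) :
                Matrix (Fin 3) (Fin 3) (PadicAlgCl p)) i i *
                  algebraMap ℚ_[p] (PadicAlgCl p)
                    ((((GaloisRep.cyclotomicCharacter (v.adicCompletion ℚ) p τ) : ℤ_[p]ˣ) :
                      ℤ_[p]) : ℚ_[p]) ^ (i : ℕ) ≠
              ((g * ρ.toLocal v τ * g⁻¹ : GL (Fin 3) (PadicAlgCl p)) :
                Matrix (Fin 3) (Fin 3) (PadicAlgCl p)) j j *
                  algebraMap ℚ_[p] (PadicAlgCl p)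
                    ((((GaloisRep.cyclotomicCharacter (v.adicCompletion ℚ) p τ) : ℤ_[p]ˣ) :
                      ℤ_[p]) : ℚ_[p]) ^ (j : ℕ))) →
      let D := Literature.NumberTheory.PAdicHodge.fontainePstAdicCompletion v p hv
      D.IsCrystallineFramed (ρ.toLocal v) ∧
        (letI := D.algebra
         ∀ τ : v.adicCompletion ℚ →ₐ[ℚ_[p]] PadicAlgCl p,
           ρ.labelledHodgeTateWeightsAt v D.algebra D.𝔅 τ.toRingHom = {0, 1, 2}) := by
  sorry

/-! **STUB 3 — LANDED** (lead c1, 2026-08-17, p161017): the lever `stub_residualDuality_of_conjDuality`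
((D′) exact `s`-duality through a residually trivial ring endomorphism ⇒ conjunct (D); with
`norm_trace_le_one`, integrality of traces of compact-image `p`-adic representations) is an accepted tree
theorem under this very name and namespace, in
`Summits/Langlands/Langlands/Theorems/RamifiedCoefficientSeedExplicitRamifiedFamilyStubResidualDuality.lean`
(`--supports stmt-Langlands-16778`, axioms `{propext, Classical.choice, Quot.sound}`); it is IMPORTED above and
used BY NAME in the composition.  Remaining sorries: STUBS 1–2. -/

/-! ## 2. The open stub statements as named propositions (the composition's hypotheses, by name) -/

namespace _Goal

/-- The statement of `stub_ordinaryConjDualCertifiedFamily` (literally its type). [folklore] -/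
def stub_ordinaryConjDualCertifiedFamily : Prop :=
  type_of% @Summit.Langlands.Langlands.Cruxes.ExplicitRamifiedFamily.Birth.stub_ordinaryConjDualCertifiedFamily

/-- The statement of `stub_pinnedCrystalline_of_ordinaryGeneric` (literally its type). [folklore] -/
def stub_pinnedCrystalline_of_ordinaryGeneric : Prop :=
  type_of% @Summit.Langlands.Langlands.Cruxes.ExplicitRamifiedFamily.Birth.stub_pinnedCrystalline_of_ordinaryGeneric

end _Goal

/-! ## 3. The composition (kernel-checked, no `sorry`): core + transfer + lever + landed certificate lemmas → crux by name -/

/-- **`ExplicitRamifiedFamily` from the three open stubs and the two landed certificate lemmas.**  Unpack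
the certified family of STUB 1; pairs: feed each certificate to the LANDED
`stub_not_twistEquivalent_of_certificate`; members: the non-self-duality certificate goes to the LANDED
`stub_not_essSelfDual_of_certificate`, the ORD-GEN(0,1,2) datum at each `v ∣ p` to the transfer STUB 2
(which returns exactly the crux's pinned-crystalline-with-weights clause), the exact `s`-duality to the
LANDED lever `stub_residualDuality_of_conjDuality` (which returns conjunct (D)); (B), (E), (F) pass through verbatim.  Conclusion: the route decl
`Summit.Langlands.Langlands.Theses.RamifiedCoefficientSeed.ExplicitRamifiedFamily`, by name. [folklore] -/
theorem ExplicitRamifiedFamily_of (h₁ : _Goal.stub_ordinaryConjDualCertifiedFamily)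
    (h₂ : _Goal.stub_pinnedCrystalline_of_ordinaryGeneric) :
    Summit.Langlands.Langlands.Theses.RamifiedCoefficientSeed.ExplicitRamifiedFamily := by
  unfold _Goal.stub_ordinaryConjDualCertifiedFamily at h₁
  unfold _Goal.stub_pinnedCrystalline_of_ordinaryGeneric at h₂
  obtain ⟨p, hp, h11, f, hpairs, hf⟩ := h₁
  refine ⟨p, hp, h11, f, ?_, ?_⟩
  · -- pairwise twist-inequivalence, from the pair certificates (landed, wave 1)
    intro m n hmn
    exact stub_not_twistEquivalent_of_certificate p ℚ (f m) (f n) (hpairs m n hmn)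
  · intro n
    obtain ⟨hcert, hunr, hord, ⟨ν, s, hs, hdual⟩, hirr, hcc⟩ := hf n
    exact ⟨stub_not_essSelfDual_of_certificate p ℚ (f n) hcert, hunr,
      fun v hv => h₂ p (f n) v hv (hord v hv), ⟨ν, stub_residualDuality_of_conjDuality p ℚ (f n) ν s hs hdual⟩, hirr, hcc⟩

/-- By-name sanity check (an `example`, not a declaration of the file): the open stubs feed the
composition as they stand. -/
example : Summit.Langlands.Langlands.Theses.RamifiedCoefficientSeed.ExplicitRamifiedFamily :=
  ExplicitRamifiedFamily_of stub_ordinaryConjDualCertifiedFamily stub_pinnedCrystalline_of_ordinaryGeneric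

end Summit.Langlands.Langlands.Cruxes.ExplicitRamifiedFamily.Birth

end
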